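import Literature.MathematicalPhysics.QuantumLattice.KomaTasakiSSBOverlap
import HarnessLib

/-!
# Long-range order ⟹ sourced order `≥ √2 σ` under a symmetry-breaking field, `U(1)` case:
# Koma–Tasaki 1993 Theorem 7.3 in finite volume with explicit constants (bounded-overlap densities)

T. Koma, H. Tasaki, *Symmetry breaking in Heisenberg antiferromagnets*, Commun. Math. Phys. **158**
(1993) 191–214 (`KomaTasaki1993`, held as `paper:doi-10-1007-bf02097237`), §7, Theorem 7.3 (p. 211)
and its proof (7.23)–(7.26) (pp. 212–213):

> **Theorem 7.3.** Assume that the conditions for Theorem 7.1 are valid, and we further have the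
> `U(1)` invariance … Also assume that `σ` defined in (7.1) is nonvanishing.  Then
> `liminf_{B↓0} liminf_{Λ↑ℤ^d} N⁻¹ (Φ_Λ(B), O^{(1)}_Λ Φ_Λ(B)) ≥ √2 σ`.                          (7.11)

Here `Φ_Λ(B)` is ANY ground state of the sourced Hamiltonian `H_Λ(B) = H_Λ - B O^{(1)}_Λ` (KT93 (2.6))
and `σ = lim N⁻¹ √(Φ_Λ, (O^{(1)}_Λ)² Φ_Λ)` is the long-range order of the symmetric ground states
`Φ_Λ` (7.1).  The printed proof: the variational state
`Ψ_Λ = (2k+1)^{-1/2} Σ_{n=-k}^{k} (O^±)^{|n|}Φ_Λ/‖(O^±)^{|n|}Φ_Λ‖` (7.23) (= KT94's `Ξ^{(k)}`, tree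
`U1System.xiState`) "is normalized" since "the states in the sum of (7.23) are orthogonal to each
other"; its energy obeys (7.24)
`(Ψ_Λ, H_Λ Ψ_Λ) - E₀ = (2k+1)⁻¹ Σ_{n=1}^{k} [ (Φ,(O^-)ⁿ[H,(O^+)ⁿ]Φ)/(Φ,(O^-)ⁿ(O^+)ⁿΦ) + (+ ↔ -) ]`
`≤ 2h̄k(ō/σ)^{2k} + O(N⁻¹)` — an `N`-UNIFORM constant obtained from the commutator bound (7.22)
`‖[H_Λ, O_Λ]‖ ≤ 4 ō h̄ r` per site (hypotheses ii) norm bounds, iii) range `r`; KT93 Remark p. 213: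
"This estimate is far from being optimal", refined later as KT94 Theorem 2.3); its order parameter obeys
(7.25)–(7.26) `(Ψ_Λ, O^{(1)}Ψ_Λ) ≥ (2k/(2k+1))·[(2(σ_ΛN)²)^k - O(N^{2k-1})]^{1/(2k)}`; and "By
substituting (7.24) and (7.26) into the basic variational estimate (7.5)
[`B(Φ_Λ(B),O_ΛΦ_Λ(B)) ≥ B(Ψ_Λ,O_ΛΨ_Λ) - {(Ψ_Λ,H_ΛΨ_Λ) - E₀}`], and by letting `N ↑ ∞` and `k ↑ ∞`,
one gets the desired (7.11)."

## What this file proves (sorry-free, no named facts)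

The trial-state half (7.25)–(7.26) is already PROVED in the tree, for KT94's `U1System` (hypothesis i)
`[o_x, o_y] = 0`, `x ≠ y`) in `KomaTasakiSSBOrderParameter.lean` (`U1System.theorem_2_5_orderOne_fin`)
and for the BOUNDED-OVERLAP systems `U1OverlapSystem` (i′) `[o_x,o_y] = 0` unless `y ∈ T_x`,
`|T_x| ≤ r′` — bond / `d`-wave pair fields of lattice electrons) in `KomaTasakiSSBOverlap.lean`
(`U1OverlapSystem.theorem_2_5_orderOne_fin`, `theorem_2_5_orderOne_overlap_holds`).  This file adds the
FIELD TRANSFER, i.e. the rest of the printed proof, over `U1OverlapSystem` (hence over `U1System`):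

* abstract part (any complex inner-product space): `field_order_ge_of_trial` — the variational step
  (7.5) for an ARBITRARY unit trial state (`Re⟨Ξ,HΞ⟩ ≤ E₀ + δ`, `Re⟨Ξ,OΞ⟩ ≥ s`, `E₀` the ground-state
  energy of `H`, `Φ_B` a ground state of `H - B·O`, `B > 0` ⟹ `Re⟨Φ_B,OΦ_B⟩ ≥ s - δ/B`);
  `norm_comm_pow_succ_le` (`‖[H,P^{n+1}]‖ ≤ (n+1)‖P‖ⁿ‖[H,P]‖`); `re_inner_normalize_hamiltonian_le`
  (the tower-state energy `Re⟨PΦ/‖PΦ‖, H PΦ/‖PΦ‖⟩ ≤ E₀ + ‖[H,P]‖/‖PΦ‖` for an eigenvector `Φ`,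
  the per-term content of (7.24));
* `U1System.inner_sum_apply_sum_of_eigen_C` (charge bookkeeping: a charge-conserving `X` is block
  diagonal on `C`-eigenvectors with distinct eigenvalues), whence `U1System.norm_xiState`
  (**`‖Ξ^{(k)}‖ = 1`** as soon as `(O^±)^kΦ ≠ 0`, KT93 after (7.23)) and
  `U1System.re_inner_xiState_hamiltonian_le` (**(7.24)**:
  `Re⟨Ξ^{(k)},HΞ^{(k)}⟩ ≤ E + (2k+1)⁻¹ Σ_{n=1}^{k} (‖[H,(O^+)ⁿ]‖/‖(O^+)ⁿΦ‖ + ‖[H,(O^-)ⁿ]‖/‖(O^-)ⁿΦ‖)`);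
* `U1OverlapSystem.norm_comm_hamiltonian_order_le` (**(7.22)**: `‖[H_Λ, O^{(α)}_Λ]‖ ≤ 2 h̄ o r N` from
  ii)+iii)), `norm_comm_hamiltonian_orderPlus_le` / `…orderMinus_le` (`≤ 4 h̄ o r N`);
* `U1OverlapSystem.field_order_ge_xiState` (**KT93 Thm 7.3, finite volume, every `N`, `k`, `B > 0`**):
  for a ground state `Φ` with obscured symmetry breaking iv) (2.17) and every ground state `Φ_B` of
  `H - B·O^{(1)}`,
  `Re⟨Φ_B, O^{(1)}Φ_B⟩ ≥ Re⟨Ξ^{(k)},O^{(1)}Ξ^{(k)}⟩ - δ_k/B`,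
  `δ_k = (2k+1)⁻¹ Σ_{n=1}^{k} n(2oN)^{n-1}(4h̄orN)(‖(O^+)ⁿΦ‖⁻¹ + ‖(O^-)ⁿΦ‖⁻¹)`;
* `U1OverlapSystem.field_order_ge_xiState_of_card_ge`: under the size condition
  `k² r′ 2^k ≤ μ^{2k} N` the moment bounds of `KomaTasakiSSBOverlap` give `‖(O^±)ⁿΦ‖ ≥ (μoN)ⁿ`
  (`norm_orderPlus_pow_apply_ge`), hence the `N`-UNIFORM constant
  `δ_k ≤ D_k := k·2^{k+1}·h̄·r/μ^k` and `Re⟨Φ_B,O^{(1)}Φ_B⟩ ≥ Re⟨Ξ^{(k)},O^{(1)}Ξ^{(k)}⟩ - D_k/B`;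
* `komaTasakiU1Field` / `komaTasakiU1Field_holds` (**(7.11) in `ε`–`N₀` form, uniform over the class**):
  for all `μ, o`, bounds `R ≥ r′`, `r₀ ≥ r`, `h₀ ≥ h̄`, every `B > 0` and `ε > 0` there is `N₀` with
  `N⁻¹ Re⟨Φ_B, O^{(1)}Φ_B⟩ ≥ √2 μ o - ε` for every system of the class on `N ≥ N₀` sites, every LRO
  ground state `Φ` (parameter `μ`) and every ground state `Φ_B` of `H - B·O^{(1)}` — i.e.
  `liminf_N N⁻¹(Φ_Λ(B),O^{(1)}Φ_Λ(B)) ≥ √2 μ o` for EVERY `B > 0`, in particular (7.11);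
  `komaTasakiU1Field_seq` (along lattices with `N_j → ∞`, `∀ᶠ j`);
* the `U1System` specialisations `U1System.field_order_ge_xiState_of_card_ge`, `komaTasakiU1Field_u1`.

Direction (as everywhere in this family): LRO of the symmetric ground state ⟹ response under the
field.  Read contrapositively at fixed `B > 0` it is a CEILING on the long-range order of the `B = 0`
ground states from a certified sourced one-point function ("`m(B) < √2 μ o - ε` for some `N ≥ N₀` ⟹ no
ground state with LRO parameter `μ`"), the node the cell's sourced-window programme consumes
(cell `pub/hubbard-cq`, START-HERE §4 row p4 / obsth-3 (3)).  The converse (response ⟹ LRO) is not a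
theorem (`Literature.Barriers.HubbardSuperconductivity.SourcedOrderWithoutGroundStateLRO`,
`…FiniteFieldResponseWithoutLRO`).

## Deviations from the printed proof (stated)

1. (7.24) bounds `(Φ,(O^-)ⁿ[H,(O^+)ⁿ]Φ) ≤ ‖(O^-)ⁿ‖·‖[H,(O^+)ⁿ]‖`; we use the slightly better
   `|((O^+)ⁿΦ, [H,(O^+)ⁿ]Φ)| ≤ ‖(O^+)ⁿΦ‖·‖[H,(O^+)ⁿ]‖` (one power of the state norm instead of the
   operator norm), which gives `D_k = k 2^{k+1} h̄ r μ^{-k}` in place of `2h̄k(ō/σ)^{2k}`; both are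
   `N`-uniform and exponential in `k`, which is all the double limit uses.
2. The denominators are controlled by the bounded-overlap moment bounds
   `‖(O^±)ⁿΦ‖² ≥ (2μ²o²N²)ⁿ - n²(or′)(2oN)^{2n-1}` of `KomaTasakiSSBOverlap` (KT93 (7.15)+(7.18) with
   `o ↦ o r′` in the error term), so hypothesis i) is only used in its bounded-overlap form i′).
3. `σ` is rendered, as in the tree's KT files, by the LRO parameter `μ o` of hypothesis iv) (2.17)
   (`(Φ,(O^{(1)})²Φ) ≥ (μ o N)²`); the theorem is uniform in the class, so `σ_Λ → σ` is the user's choice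
   of `μ`.

## Mathlib / tree search

`lean search 'theorem_7_3|norm_xiState|field_order_ge'`: nothing.  Reused: `khvdl_order_ge`'s shape
(`KaplanHorschVonDerLindenFieldBound.lean`, the `k = "1/2"` KHvdL state), `U1System.xiVec_eq_sum_add_sum`,
`C_orderPlus_pow_apply`, `C_orderMinus_pow_apply`, `inner_eq_zero_of_eigen_C`, `conj_eq_of_eigen_C`,
`re_inner_normalize_apply` (`KomaTasakiSSB*`), `norm_comm_le`, `norm_pow_le_of_le`
(`KomaTasakiSSBProofs`), `U1OverlapSystem.norm_sq_orderPlus_pow_ge`/`…Minus…`,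
`theorem_2_5_orderOne_overlap_holds` (`KomaTasakiSSBOverlap`); Mathlib `Finset.sum_disjSum`,
`Finset.sum_eq_single_of_mem`, `norm_smul_inv_norm`, `sq_le_sq₀`.
-/

noncomputable section

open Complex Finset Filter
open scoped InnerProductSpace ComplexConjugate Topology

namespace Literature.MathematicalPhysics.QuantumLattice.KomaTasaki

universe u v

/-! ### Abstract part: the variational step for a general trial state, commutators with powers,
energies of tower states -/

section Abstract

variable {E : Type v} [NormedAddCommGroup E] [InnerProductSpace ℂ E]

/-- Expectation of the sourced Hamiltonian: `Re⟨ψ,(H - B·O)ψ⟩ = Re⟨ψ,Hψ⟩ - B·Re⟨ψ,Oψ⟩`.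
[cite: KomaTasaki1993, (2.6)] -/
theorem re_inner_field_apply (H O : E →L[ℂ] E) (B : ℝ) (ψ : E) :
    (⟪ψ, (H - (B : ℂ) • O) ψ⟫_ℂ).re = (⟪ψ, H ψ⟫_ℂ).re - B * (⟪ψ, O ψ⟫_ℂ).re := by
  rw [sub_apply, smul_apply, inner_sub_right,
    inner_smul_right, Complex.sub_re, Complex.re_ofReal_mul]

/-- **KT93 (7.5), the basic variational estimate, for an arbitrary trial state.**  Let `E₀` be the
ground-state energy of `H` (`E₀ ≤ Re⟨ψ,Hψ⟩` for unit `ψ`), `Ξ` a unit vector with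
`Re⟨Ξ,HΞ⟩ ≤ E₀ + δ` and `Re⟨Ξ,OΞ⟩ ≥ s`, `B > 0`, and `Φ_B` a unit minimiser of `Re⟨ψ,(H - B·O)ψ⟩`
(a ground state of `H(B) = H - B O`).  Then `Re⟨Φ_B, OΦ_B⟩ ≥ s - δ/B`
("`±(Φ_Λ(B),O_ΛΦ_Λ(B)) ≥ (Ψ_Λ,O_ΛΨ_Λ) - B⁻¹{(Ψ_Λ,H_ΛΨ_Λ) - E₀}`").
[cite: KomaTasaki1993, Theorem 7.1 proof (7.4)–(7.5); Theorem 7.3 proof, last paragraph] -/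
theorem field_order_ge_of_trial {H O : E →L[ℂ] E} {E₀ δ s B : ℝ} {Ξ ΦB : E}
    (hground : ∀ ψ : E, ‖ψ‖ = 1 → E₀ ≤ (⟪ψ, H ψ⟫_ℂ).re)
    (hΞ : ‖Ξ‖ = 1) (hΞH : (⟪Ξ, H Ξ⟫_ℂ).re ≤ E₀ + δ) (hΞO : s ≤ (⟪Ξ, O Ξ⟫_ℂ).re)
    (hB : 0 < B) (hΦB : ‖ΦB‖ = 1)
    (hmin : ∀ ψ : E, ‖ψ‖ = 1 →
      (⟪ΦB, (H - (B : ℂ) • O) ΦB⟫_ℂ).re ≤ (⟪ψ, (H - (B : ℂ) • O) ψ⟫_ℂ).re) :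
    s - δ / B ≤ (⟪ΦB, O ΦB⟫_ℂ).re := by
  have h1 := hmin Ξ hΞ
  rw [re_inner_field_apply, re_inner_field_apply] at h1
  have h3 := hground ΦB hΦB
  have h4 : B * s ≤ B * (⟪Ξ, O Ξ⟫_ℂ).re := mul_le_mul_of_nonneg_left hΞO hB.le
  have key : B * s - δ ≤ B * (⟪ΦB, O ΦB⟫_ℂ).re := by linarith
  have e : s - δ / B = (B * s - δ) / B := by field_simp
  rw [e, div_le_iff₀ hB]
  linarith

/-- **Commutator with a power**: `‖[H, P^{n+1}]‖ ≤ (n+1) αⁿ κ` when `‖P‖ ≤ α` and `‖[H,P]‖ ≤ κ`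
(`[H,P^{n+1}] = [H,Pⁿ]P + Pⁿ[H,P]`; KT93 (7.21): "one can rearrange alignments of the `2n` operators
by exchanging neighboring operators at most `2n` times"). [cite: KomaTasaki1993, Lemma 7.5 proof (7.21)] -/
theorem norm_comm_pow_succ_le (H P : E →L[ℂ] E) {α κ : ℝ} (hα : ‖P‖ ≤ α)
    (hκ : ‖H * P - P * H‖ ≤ κ) (n : ℕ) :
    ‖H * P ^ (n + 1) - P ^ (n + 1) * H‖ ≤ (n + 1) * α ^ n * κ := by
  have hα0 : 0 ≤ α := (norm_nonneg _).trans hα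
  have hκ0 : 0 ≤ κ := (norm_nonneg _).trans hκ
  induction n with
  | zero => simpa using hκ
  | succ n ih =>
    have hid : H * P ^ (n + 1 + 1) - P ^ (n + 1 + 1) * H =
        (H * P ^ (n + 1) - P ^ (n + 1) * H) * P + P ^ (n + 1) * (H * P - P * H) := by
      rw [pow_succ P (n + 1)]
      noncomm_ring
    rw [hid]
    have hPn : ‖P ^ (n + 1)‖ ≤ α ^ (n + 1) := norm_pow_le_of_le hα (n + 1)
    calc ‖(H * P ^ (n + 1) - P ^ (n + 1) * H) * P + P ^ (n + 1) * (H * P - P * H)‖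
        ≤ ‖(H * P ^ (n + 1) - P ^ (n + 1) * H) * P‖ + ‖P ^ (n + 1) * (H * P - P * H)‖ :=
          norm_add_le _ _
      _ ≤ ‖H * P ^ (n + 1) - P ^ (n + 1) * H‖ * ‖P‖ + ‖P ^ (n + 1)‖ * ‖H * P - P * H‖ :=
          add_le_add (norm_mul_le _ _) (norm_mul_le _ _)
      _ ≤ ((n + 1) * α ^ n * κ) * α + α ^ (n + 1) * κ := by
          gcongr
      _ = ((n + 1 : ℕ) + 1) * α ^ (n + 1) * κ := by push_cast; ring

/-- **Energy of a tower state, unnormalised** (the per-term content of KT93 (7.24)): for a symmetric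
`H` with `HΦ = E₀Φ`, `‖Φ‖ = 1`, and any bounded `T`,
`Re⟨TΦ, H TΦ⟩ - E₀‖TΦ‖² = Re⟨TΦ, [H,T]Φ⟩ ≤ ‖TΦ‖·‖[H,T]‖`.
[cite: KomaTasaki1993, Theorem 7.3 proof (7.24)] -/
theorem re_inner_apply_hamiltonian_le {H T : E →L[ℂ] E} {Φ : E} {E₀ : ℝ}
    (hΦ : ‖Φ‖ = 1) (hHΦ : H Φ = (E₀ : ℂ) • Φ) :
    (⟪T Φ, H (T Φ)⟫_ℂ).re - E₀ * ‖T Φ‖ ^ 2 ≤ ‖T Φ‖ * ‖H * T - T * H‖ := by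
  have h1 : H (T Φ) = (H * T - T * H) Φ + (E₀ : ℂ) • T Φ := by
    rw [sub_apply, mul_apply_eq_comp,
      mul_apply_eq_comp, hHΦ, map_smul]
    abel
  have h2 : (⟪T Φ, (E₀ : ℂ) • T Φ⟫_ℂ).re = E₀ * ‖T Φ‖ ^ 2 := by
    rw [inner_smul_right, inner_self_eq_norm_sq_to_K, Complex.re_ofReal_mul]
    norm_cast
  rw [h1, inner_add_right, Complex.add_re, h2, add_sub_cancel_right]
  calc (⟪T Φ, (H * T - T * H) Φ⟫_ℂ).re ≤ ‖⟪T Φ, (H * T - T * H) Φ⟫_ℂ‖ := Complex.re_le_norm _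
    _ ≤ ‖T Φ‖ * ‖(H * T - T * H) Φ‖ := norm_inner_le_norm _ _
    _ ≤ ‖T Φ‖ * (‖H * T - T * H‖ * ‖Φ‖) := by
        gcongr; exact (H * T - T * H).le_opNorm Φ
    _ = ‖T Φ‖ * ‖H * T - T * H‖ := by rw [hΦ, mul_one]

/-- **Energy of a tower state** `Ψ = TΦ/‖TΦ‖` (KT93 (7.24), one term; KT94 (2.19)): for a symmetric
`H` with `HΦ = E₀Φ`, `‖Φ‖ = 1` and `TΦ ≠ 0`, `Re⟨Ψ, HΨ⟩ ≤ E₀ + ‖[H,T]‖/‖TΦ‖`.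
[cite: KomaTasaki1993, Theorem 7.3 proof (7.24)] -/
theorem re_inner_normalize_hamiltonian_le {H T : E →L[ℂ] E} {Φ : E} {E₀ : ℝ}
    (hΦ : ‖Φ‖ = 1) (hHΦ : H Φ = (E₀ : ℂ) • Φ) (hne : T Φ ≠ 0) :
    (⟪(‖T Φ‖⁻¹ : ℂ) • T Φ, H ((‖T Φ‖⁻¹ : ℂ) • T Φ)⟫_ℂ).re ≤ E₀ + ‖H * T - T * H‖ / ‖T Φ‖ := by
  have hpos : 0 < ‖T Φ‖ := norm_pos_iff.mpr hne
  rw [re_inner_normalize_apply, div_le_iff₀ (pow_pos hpos 2)]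
  have h := re_inner_apply_hamiltonian_le (T := T) hΦ hHΦ
  have e : (E₀ + ‖H * T - T * H‖ / ‖T Φ‖) * ‖T Φ‖ ^ 2 =
      E₀ * ‖T Φ‖ ^ 2 + ‖T Φ‖ * ‖H * T - T * H‖ := by
    field_simp
  rw [e]
  linarith

/-- `‖ v/‖v‖ ‖ = 1` for `v ≠ 0` (with the scalar `(‖v‖ : ℂ)⁻¹`, the tree's normalisation of
`Ψ^{(M)}`). [folklore] -/
private theorem norm_inv_norm_smul_eq_one {v : E} (hv : v ≠ 0) : ‖(‖v‖⁻¹ : ℂ) • v‖ = 1 := by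
  have hpos : 0 < ‖v‖ := norm_pos_iff.mpr hv
  rw [norm_smul, norm_inv, Complex.norm_real, Real.norm_eq_abs, abs_of_pos hpos,
    inv_mul_cancel₀ hpos.ne']

/-- If `(P^k)Φ ≠ 0` then `(P^j)Φ ≠ 0` for all `j ≤ k` (`P^k = P^{k-j}P^j`). [folklore] -/
private theorem pow_apply_ne_zero_of_le {P : E →L[ℂ] E} {Φ : E} {j k : ℕ} (hjk : j ≤ k)
    (hk : (P ^ k) Φ ≠ 0) : (P ^ j) Φ ≠ 0 := by
  intro hj
  apply hk
  have : P ^ k = P ^ (k - j) * P ^ j := by rw [← pow_add, Nat.sub_add_cancel hjk]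
  rw [this, mul_apply_eq_comp, hj, map_zero]

end Abstract

/-! ### Charge bookkeeping for the symmetry-breaking state `Ξ^{(k)}`: norm and energy -/

namespace U1System

variable {Λ : Type u} [Fintype Λ] {E : Type v} [NormedAddCommGroup E] [InnerProductSpace ℂ E]
variable (sys : U1System Λ E)

/-- **A charge-conserving operator is block diagonal on `C`-eigenvectors with distinct (real)
eigenvalues**: if `C v_i = a_i v_i` with the `a_i ∈ ℝ` pairwise distinct on `s` and `X C = C X`, then
`⟨Σ_i v_i, X Σ_i v_i⟩ = Σ_i ⟨v_i, X v_i⟩` (KT93 p. 212 "the states in the sum of (7.23) are orthogonal to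
each other"; KT94 proof of Thm 2.5, first display). [cite: KomaTasaki1993, Theorem 7.3 proof (7.23)–(7.24)]
[cite: KomaTasaki1994, Theorem 2.5 proof] -/
theorem inner_sum_apply_sum_of_eigen_C {ι : Type*} (s : Finset ι) (v : ι → E) (a : ι → ℝ)
    (hv : ∀ i ∈ s, sys.C (v i) = ((a i : ℝ) : ℂ) • v i) (ha : Set.InjOn a s)
    (X : E →L[ℂ] E) (hX : X * sys.C = sys.C * X) :
    ⟪∑ i ∈ s, v i, X (∑ i ∈ s, v i)⟫_ℂ = ∑ i ∈ s, ⟪v i, X (v i)⟫_ℂ := by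
  rw [map_sum, sum_inner]
  refine Finset.sum_congr rfl fun i hi => ?_
  rw [inner_sum]
  refine Finset.sum_eq_single_of_mem i hi fun j hj hji => ?_
  have hXj : sys.C (X (v j)) = ((a j : ℝ) : ℂ) • X (v j) := by
    have h := congrArg (fun T : E →L[ℂ] E => T (v j)) hX
    simp only [mul_apply_eq_comp] at h
    rw [← h, hv j hj, map_smul]
  refine sys.inner_eq_zero_of_eigen_C (hv i hi) hXj ?_
  rw [Complex.conj_ofReal]
  intro h
  exact hji (ha hi hj (Complex.ofReal_injective h)).symm

/-- **The matrix element `⟨ξ^{(k)}, X ξ^{(k)}⟩` of a charge-conserving `X`** (`X C = C X`; e.g. `X = 1`,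
`X = H_Λ`) in the unnormalised symmetry-breaking vector `ξ^{(k)} = Σ_{|M| ≤ k} Ψ^{(M)}` built on a unit
`C`-eigenvector `Φ`: only the diagonal terms survive,
`⟨ξ^{(k)}, X ξ^{(k)}⟩ = Σ_{j=0}^{k} ⟨Ψ^{(j)}, XΨ^{(j)}⟩ + Σ_{j=1}^{k} ⟨Ψ^{(-j)}, XΨ^{(-j)}⟩`
(`Ψ^{(±j)} = (O^±)^jΦ/‖(O^±)^jΦ‖`, charges `c ± j`). [cite: KomaTasaki1993, Theorem 7.3 proof (7.23)–(7.24)]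
[cite: KomaTasaki1994, (2.16), (2.27)] -/
theorem inner_xiVec_apply_xiVec (k : ℕ) {Φ : E} {c : ℂ} (hΦ : ‖Φ‖ = 1)
    (hC : sys.C Φ = c • Φ) (X : E →L[ℂ] E) (hX : X * sys.C = sys.C * X) :
    ⟪sys.xiVec k Φ, X (sys.xiVec k Φ)⟫_ℂ =
      ∑ j ∈ range (k + 1),
          ⟪(‖(sys.orderPlus ^ j) Φ‖⁻¹ : ℂ) • (sys.orderPlus ^ j) Φ,
            X ((‖(sys.orderPlus ^ j) Φ‖⁻¹ : ℂ) • (sys.orderPlus ^ j) Φ)⟫_ℂ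
        + ∑ j ∈ range k,
          ⟪(‖(sys.orderMinus ^ (j + 1)) Φ‖⁻¹ : ℂ) • (sys.orderMinus ^ (j + 1)) Φ,
            X ((‖(sys.orderMinus ^ (j + 1)) Φ‖⁻¹ : ℂ) • (sys.orderMinus ^ (j + 1)) Φ)⟫_ℂ := by
  have hΦ0 : Φ ≠ 0 := by
    intro h; rw [h, norm_zero] at hΦ; exact zero_ne_one hΦ
  have hc : conj c = c := sys.conj_eq_of_eigen_C hΦ0 hC
  have hcre : ((c.re : ℝ) : ℂ) = c := Complex.conj_eq_iff_re.mp hc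
  -- the orthogonal family, indexed by `ℕ ⊕ ℕ`
  set v : ℕ ⊕ ℕ → E := Sum.elim
    (fun j => (‖(sys.orderPlus ^ j) Φ‖⁻¹ : ℂ) • (sys.orderPlus ^ j) Φ)
    (fun j => (‖(sys.orderMinus ^ (j + 1)) Φ‖⁻¹ : ℂ) • (sys.orderMinus ^ (j + 1)) Φ) with hv_def
  set a : ℕ ⊕ ℕ → ℝ := Sum.elim (fun j => c.re + j) (fun j => c.re - (j + 1)) with ha_def
  set s : Finset (ℕ ⊕ ℕ) := (range (k + 1)).disjSum (range k) with hs_def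
  have hxi : sys.xiVec k Φ = ∑ i ∈ s, v i := by
    rw [sys.xiVec_eq_sum_add_sum k hΦ, hs_def, Finset.sum_disjSum]
    simp [hv_def]
  have hv : ∀ i ∈ s, sys.C (v i) = ((a i : ℝ) : ℂ) • v i := by
    intro i _
    rcases i with j | j
    · simp only [hv_def, ha_def, Sum.elim_inl, map_smul]
      rw [sys.C_orderPlus_pow_apply hC j, smul_comm]
      congr 1
      push_cast
      rw [hcre]
    · simp only [hv_def, ha_def, Sum.elim_inr, map_smul]
      rw [sys.C_orderMinus_pow_apply hC (j + 1), smul_comm]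
      congr 1
      push_cast
      rw [hcre]
  have ha : Set.InjOn a s := by
    intro i _ i' _ h
    rcases i with j | j <;> rcases i' with j' | j'
    · simp only [ha_def, Sum.elim_inl] at h
      have : (j : ℝ) = j' := by linarith
      exact congrArg Sum.inl (by exact_mod_cast this)
    · simp only [ha_def, Sum.elim_inl, Sum.elim_inr] at h
      have h1 : (0 : ℝ) ≤ j := Nat.cast_nonneg j
      have h2 : (0 : ℝ) ≤ j' := Nat.cast_nonneg j'
      exfalso; linarith
    · simp only [ha_def, Sum.elim_inl, Sum.elim_inr] at h
      have h1 : (0 : ℝ) ≤ j := Nat.cast_nonneg j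
      have h2 : (0 : ℝ) ≤ j' := Nat.cast_nonneg j'
      exfalso; linarith
    · simp only [ha_def, Sum.elim_inr] at h
      have : (j : ℝ) = j' := by linarith
      exact congrArg Sum.inr (by exact_mod_cast this)
  rw [hxi, sys.inner_sum_apply_sum_of_eigen_C s v a hv ha X hX, hs_def, Finset.sum_disjSum]
  simp [hv_def]

/-- **`‖ξ^{(k)}‖² = 2k+1`**: the `2k+1` states `Ψ^{(M)}`, `|M| ≤ k`, are unit vectors and mutually
orthogonal, provided `(O^+)^kΦ ≠ 0 ≠ (O^-)^kΦ` (then all lower powers are nonzero too).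
[cite: KomaTasaki1993, Theorem 7.3 proof, after (7.23)] [cite: KomaTasaki1994, (2.27)] -/
theorem norm_xiVec_sq (k : ℕ) {Φ : E} {c : ℂ} (hΦ : ‖Φ‖ = 1) (hC : sys.C Φ = c • Φ)
    (hP : (sys.orderPlus ^ k) Φ ≠ 0) (hM : (sys.orderMinus ^ k) Φ ≠ 0) :
    ‖sys.xiVec k Φ‖ ^ 2 = 2 * k + 1 := by
  have h := sys.inner_xiVec_apply_xiVec k hΦ hC 1 (by rw [one_mul, mul_one])
  simp only [one_apply_eq_self] at h
  have hp : ∀ j ∈ range (k + 1),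
      ⟪(‖(sys.orderPlus ^ j) Φ‖⁻¹ : ℂ) • (sys.orderPlus ^ j) Φ,
        (‖(sys.orderPlus ^ j) Φ‖⁻¹ : ℂ) • (sys.orderPlus ^ j) Φ⟫_ℂ = 1 := by
    intro j hj
    have hne : (sys.orderPlus ^ j) Φ ≠ 0 :=
      pow_apply_ne_zero_of_le (by rw [Finset.mem_range] at hj; omega) hP
    rw [inner_self_eq_norm_sq_to_K, norm_inv_norm_smul_eq_one hne]; simp
  have hm : ∀ j ∈ range k,
      ⟪(‖(sys.orderMinus ^ (j + 1)) Φ‖⁻¹ : ℂ) • (sys.orderMinus ^ (j + 1)) Φ,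
        (‖(sys.orderMinus ^ (j + 1)) Φ‖⁻¹ : ℂ) • (sys.orderMinus ^ (j + 1)) Φ⟫_ℂ = 1 := by
    intro j hj
    have hne : (sys.orderMinus ^ (j + 1)) Φ ≠ 0 :=
      pow_apply_ne_zero_of_le (by rw [Finset.mem_range] at hj; omega) hM
    rw [inner_self_eq_norm_sq_to_K, norm_inv_norm_smul_eq_one hne]; simp
  rw [Finset.sum_congr rfl hp, Finset.sum_congr rfl hm, Finset.sum_const, Finset.sum_const,
    Finset.card_range, Finset.card_range] at h
  simp only [nsmul_eq_mul, mul_one] at h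
  rw [norm_sq_eq_re_inner_self, h]
  push_cast
  simp only [Complex.add_re, Complex.natCast_re, Complex.one_re]
  ring

/-- **`‖Ξ^{(k)}‖ = 1`**: the symmetry-breaking trial state (KT94 (2.27) = KT93 (7.23)) is normalised
whenever `(O^+)^kΦ ≠ 0 ≠ (O^-)^kΦ` ("Since the states in the sum of (7.23) are orthogonal to each other,
the state `Ψ_Λ` is normalized"). [cite: KomaTasaki1993, Theorem 7.3 proof, after (7.23)]
[cite: KomaTasaki1994, (2.27)] -/
theorem norm_xiState (k : ℕ) {Φ : E} {c : ℂ} (hΦ : ‖Φ‖ = 1) (hC : sys.C Φ = c • Φ)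
    (hP : (sys.orderPlus ^ k) Φ ≠ 0) (hM : (sys.orderMinus ^ k) Φ ≠ 0) :
    ‖sys.xiState k Φ‖ = 1 := by
  have hsq := sys.norm_xiVec_sq k hΦ hC hP hM
  have hs : 0 < Real.sqrt (2 * k + 1) := Real.sqrt_pos.mpr (by positivity)
  have hn : ‖sys.xiVec k Φ‖ = Real.sqrt (2 * k + 1) := by
    rw [← hsq, Real.sqrt_sq (norm_nonneg _)]
  rw [sys.xiState_eq_smul_xiVec, norm_smul, norm_inv, Complex.norm_real, Real.norm_eq_abs,
    abs_of_pos hs, hn, inv_mul_cancel₀ hs.ne']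

/-- **KT93 (7.24): the energy of `Ξ^{(k)}`.**  For a unit simultaneous eigenvector `Φ` of `H_Λ`
(eigenvalue `E`) and `C_Λ` with `(O^+)^kΦ ≠ 0 ≠ (O^-)^kΦ`,
`Re⟨Ξ^{(k)}, H_Λ Ξ^{(k)}⟩ ≤ E + (2k+1)⁻¹ Σ_{n=1}^{k} ( ‖[H,(O^+)ⁿ]‖/‖(O^+)ⁿΦ‖ + ‖[H,(O^-)ⁿ]‖/‖(O^-)ⁿΦ‖ )`
(cross terms vanish by charge conservation `[H,C] = 0`; each tower state contributes its commutator
energy). [cite: KomaTasaki1993, Theorem 7.3 proof (7.24)] -/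
theorem re_inner_xiState_hamiltonian_le (k : ℕ) {Φ : E} {EΛ : ℝ} {c : ℂ} (hΦ : ‖Φ‖ = 1)
    (hC : sys.C Φ = c • Φ) (hH : sys.hamiltonian Φ = (EΛ : ℂ) • Φ)
    (hP : (sys.orderPlus ^ k) Φ ≠ 0) (hM : (sys.orderMinus ^ k) Φ ≠ 0) :
    (⟪sys.xiState k Φ, sys.hamiltonian (sys.xiState k Φ)⟫_ℂ).re ≤
      EΛ + (2 * (k : ℝ) + 1)⁻¹ * ∑ j ∈ range k,
        (‖sys.hamiltonian * sys.orderPlus ^ (j + 1) - sys.orderPlus ^ (j + 1) * sys.hamiltonian‖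
            / ‖(sys.orderPlus ^ (j + 1)) Φ‖
          + ‖sys.hamiltonian * sys.orderMinus ^ (j + 1) - sys.orderMinus ^ (j + 1) * sys.hamiltonian‖
            / ‖(sys.orderMinus ^ (j + 1)) Φ‖) := by
  set H := sys.hamiltonian with hHdef
  have hHC : H * sys.C = sys.C * H := sys.commute_hamiltonian.eq
  -- `⟨Ξ, HΞ⟩ = (2k+1)⁻¹ ⟨ξ, Hξ⟩`
  have hs : 0 < (2 * (k : ℝ) + 1) := by positivity
  have hscal : (⟪sys.xiState k Φ, H (sys.xiState k Φ)⟫_ℂ).re =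
      (2 * (k : ℝ) + 1)⁻¹ * (⟪sys.xiVec k Φ, H (sys.xiVec k Φ)⟫_ℂ).re := by
    rw [sys.xiState_eq_smul_xiVec, map_smul, inner_smul_left, inner_smul_right, ← mul_assoc]
    have e : conj ((Real.sqrt (2 * k + 1))⁻¹ : ℂ) * ((Real.sqrt (2 * k + 1))⁻¹ : ℂ) =
        (((2 * (k : ℝ) + 1)⁻¹ : ℝ) : ℂ) := by
      rw [map_inv₀, Complex.conj_ofReal, ← mul_inv, ← Complex.ofReal_mul,
        Real.mul_self_sqrt hs.le, Complex.ofReal_inv]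
    rw [e, Complex.re_ofReal_mul]
  rw [hscal]
  -- expand `⟨ξ, Hξ⟩` into tower-state energies
  have hexp := sys.inner_xiVec_apply_xiVec k hΦ hC H hHC
  rw [hexp, Complex.add_re, Complex.re_sum, Complex.re_sum, Finset.sum_range_succ' _ k]
  -- the `j = 0` term is `E`
  have h0 : (⟪(‖(sys.orderPlus ^ 0) Φ‖⁻¹ : ℂ) • (sys.orderPlus ^ 0) Φ,
      H ((‖(sys.orderPlus ^ 0) Φ‖⁻¹ : ℂ) • (sys.orderPlus ^ 0) Φ)⟫_ℂ).re = EΛ := by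
    simp only [pow_zero, one_apply_eq_self, hΦ, inv_one, Complex.ofReal_one, one_smul]
    rw [hH, inner_smul_right, inner_self_eq_norm_sq_to_K, hΦ]; simp
  rw [h0]
  -- each tower term is `≤ E + ‖[H,(O^±)^{j+1}]‖/‖(O^±)^{j+1}Φ‖`
  have hp : ∀ j ∈ range k,
      (⟪(‖(sys.orderPlus ^ (j + 1)) Φ‖⁻¹ : ℂ) • (sys.orderPlus ^ (j + 1)) Φ,
          H ((‖(sys.orderPlus ^ (j + 1)) Φ‖⁻¹ : ℂ) • (sys.orderPlus ^ (j + 1)) Φ)⟫_ℂ).re ≤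
        EΛ + ‖H * sys.orderPlus ^ (j + 1) - sys.orderPlus ^ (j + 1) * H‖
          / ‖(sys.orderPlus ^ (j + 1)) Φ‖ := by
    intro j hj
    exact re_inner_normalize_hamiltonian_le hΦ hH
      (pow_apply_ne_zero_of_le (by rw [Finset.mem_range] at hj; omega) hP)
  have hm : ∀ j ∈ range k,
      (⟪(‖(sys.orderMinus ^ (j + 1)) Φ‖⁻¹ : ℂ) • (sys.orderMinus ^ (j + 1)) Φ,
          H ((‖(sys.orderMinus ^ (j + 1)) Φ‖⁻¹ : ℂ) • (sys.orderMinus ^ (j + 1)) Φ)⟫_ℂ).re ≤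
        EΛ + ‖H * sys.orderMinus ^ (j + 1) - sys.orderMinus ^ (j + 1) * H‖
          / ‖(sys.orderMinus ^ (j + 1)) Φ‖ := by
    intro j hj
    exact re_inner_normalize_hamiltonian_le hΦ hH
      (pow_apply_ne_zero_of_le (by rw [Finset.mem_range] at hj; omega) hM)
  have hsum1 := Finset.sum_le_sum hp
  have hsum2 := Finset.sum_le_sum hm
  rw [Finset.sum_add_distrib, Finset.sum_const, Finset.card_range, nsmul_eq_mul] at hsum1 hsum2
  -- assemble: `(2k+1)⁻¹ ((Σ⁺ + E) + Σ⁻) ≤ E + (2k+1)⁻¹ Σ (c⁺ + c⁻)`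
  rw [Finset.sum_add_distrib, mul_add (2 * (k : ℝ) + 1)⁻¹]
  have hk1 : (2 * (k : ℝ) + 1)⁻¹ * ((k : ℝ) * EΛ + EΛ + (k : ℝ) * EΛ) = EΛ := by
    field_simp; ring
  have hinv : 0 ≤ (2 * (k : ℝ) + 1)⁻¹ := inv_nonneg.mpr hs.le
  nlinarith [mul_le_mul_of_nonneg_left hsum1 hinv, mul_le_mul_of_nonneg_left hsum2 hinv, hk1]

end U1System

/-! ### Locality: `‖[H_Λ, O_Λ]‖ ≤ 2 h̄ o r N` from ii)+iii) (KT93 (7.22)) -/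

namespace U1OverlapSystem

variable {Λ : Type u} [Fintype Λ] {E : Type v} [NormedAddCommGroup E] [InnerProductSpace ℂ E]
variable (sys : U1OverlapSystem Λ E)

/-- **KT93 (7.22): `‖[H_Λ, O^{(α)}_Λ]‖ ≤ 2 h̄ o r N`** — only the pairs `y ∈ S_x` contribute to
`[Σ_x h_x, Σ_y o_y]` (hypothesis ii)), each with norm `≤ 2 h̄ o` (iii)), and `|S_x| ≤ r`
("Since we have `‖[H_Λ, O_Λ]‖ ≤ 4 ō h̄ r` [per site] from the assumptions ii) and iv)").  Hypothesis i)/i′)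
is not used. [cite: KomaTasaki1993, Lemma 7.5 proof (7.22)] [cite: KomaTasaki1994, §2.3 ii) iii)] -/
theorem norm_comm_hamiltonian_order_le (α : Fin 2) :
    ‖sys.hamiltonian * sys.order α - sys.order α * sys.hamiltonian‖ ≤
      2 * sys.hbar * sys.obar * sys.r * Fintype.card Λ := by
  classical
  have hexp : sys.hamiltonian * sys.order α - sys.order α * sys.hamiltonian =
      ∑ x, ∑ y ∈ sys.supp x, (sys.h x * sys.o α y - sys.o α y * sys.h x) := by
    have h2 : sys.order α * sys.hamiltonian = ∑ x, ∑ y, sys.o α y * sys.h x := by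
      rw [order, hamiltonian, Finset.sum_mul_sum, Finset.sum_comm]
    have h1 : sys.hamiltonian * sys.order α - sys.order α * sys.hamiltonian =
        ∑ x, ∑ y, (sys.h x * sys.o α y - sys.o α y * sys.h x) := by
      rw [h2, hamiltonian, order, Finset.sum_mul_sum, ← Finset.sum_sub_distrib]
      exact Finset.sum_congr rfl fun x _ => by rw [Finset.sum_sub_distrib]
    rw [h1]
    refine Finset.sum_congr rfl fun x _ => ?_
    symm
    refine Finset.sum_subset (Finset.subset_univ _) fun y _ hy => ?_
    exact sub_eq_zero.mpr (sys.commute_h_o x y hy α).eq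
  rw [hexp]
  have ho : 0 ≤ sys.obar := sys.obar_pos.le
  calc ‖∑ x, ∑ y ∈ sys.supp x, (sys.h x * sys.o α y - sys.o α y * sys.h x)‖
      ≤ ∑ x, ‖∑ y ∈ sys.supp x, (sys.h x * sys.o α y - sys.o α y * sys.h x)‖ :=
        norm_sum_le _ _
    _ ≤ ∑ x, ∑ y ∈ sys.supp x, ‖sys.h x * sys.o α y - sys.o α y * sys.h x‖ :=
        Finset.sum_le_sum fun x _ => norm_sum_le _ _
    _ ≤ ∑ x, ∑ _y ∈ sys.supp x, 2 * sys.hbar * sys.obar := by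
        refine Finset.sum_le_sum fun x _ => Finset.sum_le_sum fun y _ => ?_
        have hh : 0 ≤ sys.hbar := (norm_nonneg _).trans (sys.norm_h_le x)
        calc ‖sys.h x * sys.o α y - sys.o α y * sys.h x‖
            ≤ 2 * ‖sys.h x‖ * ‖sys.o α y‖ := norm_comm_le _ _
          _ ≤ 2 * sys.hbar * sys.obar := by
              have := sys.norm_h_le x; have := sys.norm_o_le α y
              gcongr
    _ ≤ ∑ _x : Λ, (sys.r : ℝ) * (2 * sys.hbar * sys.obar) := by
        refine Finset.sum_le_sum fun x _ => ?_
        rw [Finset.sum_const, nsmul_eq_mul]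
        have hh : 0 ≤ sys.hbar := (norm_nonneg _).trans (sys.norm_h_le x)
        have h1 : ((sys.supp x).card : ℝ) ≤ sys.r := by exact_mod_cast sys.card_supp_le x
        exact mul_le_mul_of_nonneg_right h1 (by positivity)
    _ = 2 * sys.hbar * sys.obar * sys.r * Fintype.card Λ := by
        rw [Finset.sum_const, Finset.card_univ, nsmul_eq_mul]; ring

variable [Nonempty Λ]

/-- `h̄ ≥ 0` on a nonempty lattice (`0 ≤ ‖h_x‖ ≤ h̄`). [cite: KomaTasaki1994, §2.3 iii)] -/
theorem hbar_nonneg : 0 ≤ sys.hbar :=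
  (norm_nonneg _).trans (sys.norm_h_le (Classical.arbitrary Λ))

/-- **`‖[H_Λ, O^+_Λ]‖ ≤ 4 h̄ o r N`** (from (7.22) for both components). [cite: KomaTasaki1993, (7.22)] -/
theorem norm_comm_hamiltonian_orderPlus_le :
    ‖sys.hamiltonian * sys.orderPlus - sys.orderPlus * sys.hamiltonian‖ ≤
      4 * sys.hbar * sys.obar * sys.r * Fintype.card Λ := by
  have h : sys.hamiltonian * sys.orderPlus - sys.orderPlus * sys.hamiltonian =
      (sys.hamiltonian * sys.order 0 - sys.order 0 * sys.hamiltonian)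
        + I • (sys.hamiltonian * sys.order 1 - sys.order 1 * sys.hamiltonian) := by
    rw [orderPlus_eq, mul_add, add_mul, mul_smul_comm, smul_mul_assoc, smul_sub]
    abel
  rw [h]
  calc _ ≤ ‖sys.hamiltonian * sys.order 0 - sys.order 0 * sys.hamiltonian‖
        + ‖I • (sys.hamiltonian * sys.order 1 - sys.order 1 * sys.hamiltonian)‖ := norm_add_le _ _
    _ = ‖sys.hamiltonian * sys.order 0 - sys.order 0 * sys.hamiltonian‖
        + ‖sys.hamiltonian * sys.order 1 - sys.order 1 * sys.hamiltonian‖ := by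
          rw [norm_smul, Complex.norm_I, one_mul]
    _ ≤ 2 * sys.hbar * sys.obar * sys.r * Fintype.card Λ
        + 2 * sys.hbar * sys.obar * sys.r * Fintype.card Λ :=
          add_le_add (sys.norm_comm_hamiltonian_order_le 0) (sys.norm_comm_hamiltonian_order_le 1)
    _ = 4 * sys.hbar * sys.obar * sys.r * Fintype.card Λ := by ring

/-- **`‖[H_Λ, O^-_Λ]‖ ≤ 4 h̄ o r N`**. [cite: KomaTasaki1993, (7.22)] -/
theorem norm_comm_hamiltonian_orderMinus_le :
    ‖sys.hamiltonian * sys.orderMinus - sys.orderMinus * sys.hamiltonian‖ ≤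
      4 * sys.hbar * sys.obar * sys.r * Fintype.card Λ := by
  have h : sys.hamiltonian * sys.orderMinus - sys.orderMinus * sys.hamiltonian =
      (sys.hamiltonian * sys.order 0 - sys.order 0 * sys.hamiltonian)
        - I • (sys.hamiltonian * sys.order 1 - sys.order 1 * sys.hamiltonian) := by
    rw [orderMinus_eq, mul_sub, sub_mul, mul_smul_comm, smul_mul_assoc, smul_sub]
    abel
  rw [h]
  calc _ ≤ ‖sys.hamiltonian * sys.order 0 - sys.order 0 * sys.hamiltonian‖
        + ‖I • (sys.hamiltonian * sys.order 1 - sys.order 1 * sys.hamiltonian)‖ := norm_sub_le _ _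
    _ = ‖sys.hamiltonian * sys.order 0 - sys.order 0 * sys.hamiltonian‖
        + ‖sys.hamiltonian * sys.order 1 - sys.order 1 * sys.hamiltonian‖ := by
          rw [norm_smul, Complex.norm_I, one_mul]
    _ ≤ 2 * sys.hbar * sys.obar * sys.r * Fintype.card Λ
        + 2 * sys.hbar * sys.obar * sys.r * Fintype.card Λ :=
          add_le_add (sys.norm_comm_hamiltonian_order_le 0) (sys.norm_comm_hamiltonian_order_le 1)
    _ = 4 * sys.hbar * sys.obar * sys.r * Fintype.card Λ := by ring

/-! ### KT93 Theorem 7.3 in finite volume: the field transfer -/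

/-- **`‖Ξ^{(k)}‖ = 1` for a bounded-overlap system** (restated from the collapse: the trial state
depends only on `O^±` and `Φ`). [cite: KomaTasaki1993, Theorem 7.3 proof, after (7.23)] -/
theorem norm_xiState (k : ℕ) {Φ : E} {c : ℂ} (hΦ : ‖Φ‖ = 1) (hC : sys.C Φ = c • Φ)
    (hP : (sys.orderPlus ^ k) Φ ≠ 0) (hM : (sys.orderMinus ^ k) Φ ≠ 0) :
    ‖sys.xiState k Φ‖ = 1 :=
  sys.collapse.norm_xiState k hΦ hC hP hM

/-- **KT93 Theorem 7.3 in finite volume (bounded-overlap densities), every `N`, `k`, `B > 0`.**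
Let `Φ` be a GROUND state of `H_Λ` with obscured symmetry breaking iv) (2.17) (unit simultaneous
eigenvector of `H_Λ`, eigenvalue `E = min`, and of `C_Λ`; `⟨Φ,(O^{(α)})²Φ⟩ ≥ (μoN)²`) with
`(O^±)^kΦ ≠ 0`, and let `Φ_B` be ANY ground state of the sourced Hamiltonian `H_Λ - B O^{(1)}_Λ`, `B > 0`.
Then, substituting (7.24) into the variational estimate (7.5),

  `Re⟨Φ_B, O^{(1)}Φ_B⟩ ≥ Re⟨Ξ^{(k)}, O^{(1)}Ξ^{(k)}⟩ - δ_k/B`,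
  `δ_k = (2k+1)⁻¹ Σ_{n=1}^{k} n (2oN)^{n-1} (4h̄orN) (‖(O^+)ⁿΦ‖⁻¹ + ‖(O^-)ⁿΦ‖⁻¹)`,

where `Re⟨Ξ^{(k)}, O^{(1)}Ξ^{(k)}⟩` is bounded below by `U1OverlapSystem.theorem_2_5_orderOne_fin`
((7.25)–(7.26)). [cite: KomaTasaki1993, Theorem 7.3, proof (7.5), (7.23)–(7.26)] -/
theorem field_order_ge_xiState {Φ : E} {EΛ μ : ℝ} (hΦ : sys.IsLROEigenstate Φ EΛ μ)
    (hground : ∀ ψ : E, ‖ψ‖ = 1 → EΛ ≤ (⟪ψ, sys.hamiltonian ψ⟫_ℂ).re)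
    {k : ℕ} (hP : (sys.orderPlus ^ k) Φ ≠ 0) (hM : (sys.orderMinus ^ k) Φ ≠ 0)
    {B : ℝ} (hB : 0 < B) {ΦB : E} (hΦB : ‖ΦB‖ = 1)
    (hmin : ∀ ψ : E, ‖ψ‖ = 1 →
      (⟪ΦB, (sys.hamiltonian - (B : ℂ) • sys.order 0) ΦB⟫_ℂ).re ≤
        (⟪ψ, (sys.hamiltonian - (B : ℂ) • sys.order 0) ψ⟫_ℂ).re) :
    (⟪sys.xiState k Φ, sys.order 0 (sys.xiState k Φ)⟫_ℂ).re
        - ((2 * (k : ℝ) + 1)⁻¹ * ∑ j ∈ range k,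
            (((j : ℝ) + 1) * (2 * sys.obar * Fintype.card Λ) ^ j
                * (4 * sys.hbar * sys.obar * sys.r * Fintype.card Λ))
              * ((‖(sys.orderPlus ^ (j + 1)) Φ‖)⁻¹ + (‖(sys.orderMinus ^ (j + 1)) Φ‖)⁻¹)) / B
      ≤ (⟪ΦB, sys.order 0 ΦB⟫_ℂ).re := by
  -- unfold the abbreviations `sys.orderPlus = sys.collapse.orderPlus` etc.
  dsimp only [U1OverlapSystem.orderPlus, U1OverlapSystem.orderMinus, U1OverlapSystem.xiState]
    at hP hM ⊢
  obtain ⟨c, hc⟩ := hΦ.eigen_C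
  -- `‖Ξ^{(k)}‖ = 1`
  have hΞ : ‖sys.collapse.xiState k Φ‖ = 1 :=
    sys.collapse.norm_xiState k hΦ.norm_eq_one hc hP hM
  -- (7.24): the energy of `Ξ^{(k)}`
  have hE := sys.collapse.re_inner_xiState_hamiltonian_le k hΦ.norm_eq_one hc hΦ.eigen_hamiltonian
    hP hM
  rw [collapse_hamiltonian] at hE
  -- (7.21)–(7.22): each commutator term
  have hOp : ‖sys.collapse.orderPlus‖ ≤ 2 * sys.obar * Fintype.card Λ := by
    -- (`U1System.norm_orderPlus_le` for the collapse, whose density bound is `o N` on one site)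
    have h := sys.collapse.norm_orderPlus_le
    rw [collapse_obar, Fintype.card_unit, Nat.cast_one, mul_one] at h
    simpa [mul_assoc] using h
  have hOm : ‖sys.collapse.orderMinus‖ ≤ 2 * sys.obar * Fintype.card Λ := by
    have h := sys.collapse.norm_orderMinus_le
    rw [collapse_obar, Fintype.card_unit, Nat.cast_one, mul_one] at h
    simpa [mul_assoc] using h
  have hκp : ‖sys.hamiltonian * sys.collapse.orderPlus - sys.collapse.orderPlus * sys.hamiltonian‖
      ≤ 4 * sys.hbar * sys.obar * sys.r * Fintype.card Λ := sys.norm_comm_hamiltonian_orderPlus_le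
  have hκm : ‖sys.hamiltonian * sys.collapse.orderMinus - sys.collapse.orderMinus * sys.hamiltonian‖
      ≤ 4 * sys.hbar * sys.obar * sys.r * Fintype.card Λ := sys.norm_comm_hamiltonian_orderMinus_le
  have hterm : ∀ j ∈ range k,
      ‖sys.hamiltonian * sys.collapse.orderPlus ^ (j + 1)
              - sys.collapse.orderPlus ^ (j + 1) * sys.hamiltonian‖
            / ‖(sys.collapse.orderPlus ^ (j + 1)) Φ‖
          + ‖sys.hamiltonian * sys.collapse.orderMinus ^ (j + 1)
              - sys.collapse.orderMinus ^ (j + 1) * sys.hamiltonian‖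
            / ‖(sys.collapse.orderMinus ^ (j + 1)) Φ‖
        ≤ (((j : ℝ) + 1) * (2 * sys.obar * Fintype.card Λ) ^ j
              * (4 * sys.hbar * sys.obar * sys.r * Fintype.card Λ))
            * ((‖(sys.collapse.orderPlus ^ (j + 1)) Φ‖)⁻¹
              + (‖(sys.collapse.orderMinus ^ (j + 1)) Φ‖)⁻¹) := by
    intro j _
    have h1 := norm_comm_pow_succ_le sys.hamiltonian sys.collapse.orderPlus hOp hκp j
    have h2 := norm_comm_pow_succ_le sys.hamiltonian sys.collapse.orderMinus hOm hκm j
    rw [mul_add, div_eq_mul_inv, div_eq_mul_inv]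
    gcongr
  have hsum := Finset.sum_le_sum hterm
  have hinv : 0 ≤ (2 * (k : ℝ) + 1)⁻¹ := inv_nonneg.mpr (by positivity)
  have hmul := mul_le_mul_of_nonneg_left hsum hinv
  -- (7.5): the variational step
  refine field_order_ge_of_trial hground hΞ ?_ le_rfl hB hΦB hmin
  linarith

/-- **Denominators under the size condition**: if `(m+1)² r′ 2^{m+1} ≤ μ^{2(m+1)} N` then the
bounded-overlap moment bound `‖(O^+)^{m+1}Φ‖² ≥ (2μ²o²N²)^{m+1} - (m+1)²(or′)(2oN)^{2m+1}` gives
`‖(O^+)^{m+1}Φ‖ ≥ (μ o N)^{m+1}` (KT93 p. 212: "the state (7.23) is well defined for sufficiently large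
`N`, with `k` fixed"). [cite: KomaTasaki1993, Lemma 7.4 (7.15), Lemma 7.5 (7.18), proof of Theorem 7.3] -/
theorem norm_orderPlus_pow_apply_ge [FiniteDimensional ℂ E] {Φ : E} {EΛ μ : ℝ}
    (hΦ : sys.IsLROEigenstate Φ EΛ μ) (m : ℕ)
    (hN : ((m : ℝ) + 1) ^ 2 * sys.r' * 2 ^ (m + 1) ≤ μ ^ (2 * (m + 1)) * Fintype.card Λ) :
    (μ * sys.obar * Fintype.card Λ) ^ (m + 1) ≤ ‖(sys.orderPlus ^ (m + 1)) Φ‖ := by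
  have hμ : 0 < μ := hΦ.mu_pos
  have ho : 0 < sys.obar := sys.obar_pos
  have hN0 : (0 : ℝ) < Fintype.card Λ := Nat.cast_pos.mpr Fintype.card_pos
  have hL := sys.norm_sq_orderPlus_pow_ge hΦ m
  have key : ((m : ℝ) + 1) ^ 2 * (sys.obar * sys.r') * (2 * sys.obar * Fintype.card Λ) ^ (2 * m + 1)
      ≤ 2 ^ m * (μ * sys.obar * Fintype.card Λ) ^ (2 * (m + 1)) := by
    have e1 : ((m : ℝ) + 1) ^ 2 * (sys.obar * sys.r') * (2 * sys.obar * Fintype.card Λ) ^ (2 * m + 1)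
        = (((m : ℝ) + 1) ^ 2 * sys.r' * 2 ^ (m + 1))
          * (2 ^ m * sys.obar ^ (2 * m + 2) * (Fintype.card Λ : ℝ) ^ (2 * m + 1)) := by
      ring
    have e2 : (2 : ℝ) ^ m * (μ * sys.obar * Fintype.card Λ) ^ (2 * (m + 1))
        = (μ ^ (2 * (m + 1)) * Fintype.card Λ)
          * (2 ^ m * sys.obar ^ (2 * m + 2) * (Fintype.card Λ : ℝ) ^ (2 * m + 1)) := by
      ring
    rw [e1, e2]
    exact mul_le_mul_of_nonneg_right hN (by positivity)
  have h2 : (2 : ℝ) ^ m * (μ * sys.obar * Fintype.card Λ) ^ (2 * (m + 1))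
      + (μ * sys.obar * Fintype.card Λ) ^ (2 * (m + 1))
        ≤ (2 * (μ * sys.obar * Fintype.card Λ) ^ 2) ^ (m + 1) := by
    have e : (2 * (μ * sys.obar * Fintype.card Λ) ^ 2) ^ (m + 1)
        = 2 ^ (m + 1) * (μ * sys.obar * Fintype.card Λ) ^ (2 * (m + 1)) := by
      rw [mul_pow, ← pow_mul]
    rw [e, pow_succ]
    have hx : 0 ≤ (μ * sys.obar * Fintype.card Λ) ^ (2 * (m + 1)) := by positivity
    have h1 : (1 : ℝ) ≤ 2 ^ m := one_le_pow₀ (by norm_num)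
    nlinarith
  have h3 : ((μ * sys.obar * Fintype.card Λ) ^ (m + 1)) ^ 2 ≤ ‖(sys.orderPlus ^ (m + 1)) Φ‖ ^ 2 := by
    rw [← pow_mul, mul_comm (m + 1) 2]
    linarith
  exact (sq_le_sq₀ (by positivity) (norm_nonneg _)).mp h3

/-- The mirror statement `‖(O^-)^{m+1}Φ‖ ≥ (μ o N)^{m+1}` under the same size condition.
[cite: KomaTasaki1993, Lemma 7.4 (7.15), Lemma 7.5 (7.18)–(7.19), proof of Theorem 7.3] -/
theorem norm_orderMinus_pow_apply_ge [FiniteDimensional ℂ E] {Φ : E} {EΛ μ : ℝ}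
    (hΦ : sys.IsLROEigenstate Φ EΛ μ) (m : ℕ)
    (hN : ((m : ℝ) + 1) ^ 2 * sys.r' * 2 ^ (m + 1) ≤ μ ^ (2 * (m + 1)) * Fintype.card Λ) :
    (μ * sys.obar * Fintype.card Λ) ^ (m + 1) ≤ ‖(sys.orderMinus ^ (m + 1)) Φ‖ := by
  have hμ : 0 < μ := hΦ.mu_pos
  have ho : 0 < sys.obar := sys.obar_pos
  have hN0 : (0 : ℝ) < Fintype.card Λ := Nat.cast_pos.mpr Fintype.card_pos
  have hL := sys.norm_sq_orderMinus_pow_ge hΦ m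
  have key : ((m : ℝ) + 1) ^ 2 * (sys.obar * sys.r') * (2 * sys.obar * Fintype.card Λ) ^ (2 * m + 1)
      ≤ 2 ^ m * (μ * sys.obar * Fintype.card Λ) ^ (2 * (m + 1)) := by
    have e1 : ((m : ℝ) + 1) ^ 2 * (sys.obar * sys.r') * (2 * sys.obar * Fintype.card Λ) ^ (2 * m + 1)
        = (((m : ℝ) + 1) ^ 2 * sys.r' * 2 ^ (m + 1))
          * (2 ^ m * sys.obar ^ (2 * m + 2) * (Fintype.card Λ : ℝ) ^ (2 * m + 1)) := by
      ring
    have e2 : (2 : ℝ) ^ m * (μ * sys.obar * Fintype.card Λ) ^ (2 * (m + 1))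
        = (μ ^ (2 * (m + 1)) * Fintype.card Λ)
          * (2 ^ m * sys.obar ^ (2 * m + 2) * (Fintype.card Λ : ℝ) ^ (2 * m + 1)) := by
      ring
    rw [e1, e2]
    exact mul_le_mul_of_nonneg_right hN (by positivity)
  have h2 : (2 : ℝ) ^ m * (μ * sys.obar * Fintype.card Λ) ^ (2 * (m + 1))
      + (μ * sys.obar * Fintype.card Λ) ^ (2 * (m + 1))
        ≤ (2 * (μ * sys.obar * Fintype.card Λ) ^ 2) ^ (m + 1) := by
    have e : (2 * (μ * sys.obar * Fintype.card Λ) ^ 2) ^ (m + 1)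
        = 2 ^ (m + 1) * (μ * sys.obar * Fintype.card Λ) ^ (2 * (m + 1)) := by
      rw [mul_pow, ← pow_mul]
    rw [e, pow_succ]
    have hx : 0 ≤ (μ * sys.obar * Fintype.card Λ) ^ (2 * (m + 1)) := by positivity
    have h1 : (1 : ℝ) ≤ 2 ^ m := one_le_pow₀ (by norm_num)
    nlinarith
  have h3 : ((μ * sys.obar * Fintype.card Λ) ^ (m + 1)) ^ 2 ≤ ‖(sys.orderMinus ^ (m + 1)) Φ‖ ^ 2 := by
    rw [← pow_mul, mul_comm (m + 1) 2]
    linarith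
  exact (sq_le_sq₀ (by positivity) (norm_nonneg _)).mp h3

/-- **KT93 Theorem 7.3 in finite volume with an `N`-uniform constant.**  Under the size condition
`k² r′ 2^k ≤ μ^{2k} N` (so that `‖(O^±)ⁿΦ‖ ≥ (μoN)ⁿ` for all `n ≤ k`, in particular `Ξ^{(k)}` is well
defined), for a ground state `Φ` with obscured symmetry breaking iv) and EVERY ground state `Φ_B` of
`H_Λ - B O^{(1)}_Λ`, `B > 0`:

  `Re⟨Φ_B, O^{(1)}Φ_B⟩ ≥ Re⟨Ξ^{(k)}, O^{(1)}Ξ^{(k)}⟩ - D_k/B`,  `D_k = k·2^{k+1}·h̄·r/μ^k`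

(KT93 (7.24): "the energy difference is smaller than a constant", here `D_k`, uniformly in `N`).
Combined with `U1OverlapSystem.theorem_2_5_orderOne_fin` (the lower bound on `Re⟨Ξ^{(k)},O^{(1)}Ξ^{(k)}⟩`,
(7.25)–(7.26)) this is the complete finite-volume content of Theorem 7.3.
[cite: KomaTasaki1993, Theorem 7.3, proof (7.5), (7.23)–(7.26)] -/
theorem field_order_ge_xiState_of_card_ge [FiniteDimensional ℂ E] {Φ : E} {EΛ μ : ℝ}
    (hΦ : sys.IsLROEigenstate Φ EΛ μ)
    (hground : ∀ ψ : E, ‖ψ‖ = 1 → EΛ ≤ (⟪ψ, sys.hamiltonian ψ⟫_ℂ).re)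
    {k : ℕ} (hk : 1 ≤ k) (hN : (k : ℝ) ^ 2 * sys.r' * 2 ^ k ≤ μ ^ (2 * k) * Fintype.card Λ)
    {B : ℝ} (hB : 0 < B) {ΦB : E} (hΦB : ‖ΦB‖ = 1)
    (hmin : ∀ ψ : E, ‖ψ‖ = 1 →
      (⟪ΦB, (sys.hamiltonian - (B : ℂ) • sys.order 0) ΦB⟫_ℂ).re ≤
        (⟪ψ, (sys.hamiltonian - (B : ℂ) • sys.order 0) ψ⟫_ℂ).re) :
    (⟪sys.xiState k Φ, sys.order 0 (sys.xiState k Φ)⟫_ℂ).re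
        - ((k : ℝ) * 2 ^ (k + 1) * sys.hbar * sys.r / μ ^ k) / B
      ≤ (⟪ΦB, sys.order 0 ΦB⟫_ℂ).re := by
  have hμ : 0 < μ := hΦ.mu_pos
  have hμ1 : μ ≤ 1 := hΦ.mu_le_one
  have ho : 0 < sys.obar := sys.obar_pos
  have hh : 0 ≤ sys.hbar := sys.hbar_nonneg
  have hN0 : (0 : ℝ) < Fintype.card Λ := Nat.cast_pos.mpr Fintype.card_pos
  -- the size condition at every `n = m + 1 ≤ k`
  have hsize : ∀ m : ℕ, m + 1 ≤ k →
      ((m : ℝ) + 1) ^ 2 * sys.r' * 2 ^ (m + 1) ≤ μ ^ (2 * (m + 1)) * Fintype.card Λ := by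
    intro m hm
    have h1' : (m : ℝ) + 1 ≤ k := by exact_mod_cast hm
    have h1 : ((m : ℝ) + 1) ^ 2 ≤ (k : ℝ) ^ 2 := pow_le_pow_left₀ (by positivity) h1' 2
    have h2 : (2 : ℝ) ^ (m + 1) ≤ 2 ^ k := pow_le_pow_right₀ (by norm_num) hm
    have h3 : μ ^ (2 * k) ≤ μ ^ (2 * (m + 1)) := pow_le_pow_of_le_one hμ.le hμ1 (by omega)
    have hr' : (0 : ℝ) ≤ sys.r' := Nat.cast_nonneg _
    calc ((m : ℝ) + 1) ^ 2 * sys.r' * 2 ^ (m + 1) ≤ (k : ℝ) ^ 2 * sys.r' * 2 ^ k := by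
          gcongr
      _ ≤ μ ^ (2 * k) * Fintype.card Λ := hN
      _ ≤ μ ^ (2 * (m + 1)) * Fintype.card Λ := mul_le_mul_of_nonneg_right h3 hN0.le
  have hPm : ∀ m : ℕ, m + 1 ≤ k →
      (μ * sys.obar * Fintype.card Λ) ^ (m + 1) ≤ ‖(sys.orderPlus ^ (m + 1)) Φ‖ :=
    fun m hm => sys.norm_orderPlus_pow_apply_ge hΦ m (hsize m hm)
  have hMm : ∀ m : ℕ, m + 1 ≤ k →
      (μ * sys.obar * Fintype.card Λ) ^ (m + 1) ≤ ‖(sys.orderMinus ^ (m + 1)) Φ‖ :=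
    fun m hm => sys.norm_orderMinus_pow_apply_ge hΦ m (hsize m hm)
  have hs : 0 < μ * sys.obar * Fintype.card Λ := by positivity
  -- `(O^±)^k Φ ≠ 0`
  obtain ⟨k', rfl⟩ : ∃ k', k = k' + 1 := ⟨k - 1, by omega⟩
  have hP : (sys.orderPlus ^ (k' + 1)) Φ ≠ 0 := by
    intro h0
    have := hPm k' le_rfl
    rw [h0, norm_zero] at this
    exact absurd this (not_le.mpr (pow_pos hs _))
  have hM : (sys.orderMinus ^ (k' + 1)) Φ ≠ 0 := by
    intro h0
    have := hMm k' le_rfl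
    rw [h0, norm_zero] at this
    exact absurd this (not_le.mpr (pow_pos hs _))
  have hfin := sys.field_order_ge_xiState hΦ hground hP hM hB hΦB hmin
  -- bound `δ_k ≤ D_k`: every summand is at most `Y = k 2^{k+2} h̄ r / μ^k`
  set Y : ℝ := ((k' : ℝ) + 1) * 2 ^ (k' + 1 + 2) * sys.hbar * sys.r / μ ^ (k' + 1) with hYdef
  have hY0 : 0 ≤ Y := by positivity
  have hterm : ∀ j ∈ range (k' + 1),
      (((j : ℝ) + 1) * (2 * sys.obar * Fintype.card Λ) ^ j
            * (4 * sys.hbar * sys.obar * sys.r * Fintype.card Λ))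
          * ((‖(sys.orderPlus ^ (j + 1)) Φ‖)⁻¹ + (‖(sys.orderMinus ^ (j + 1)) Φ‖)⁻¹) ≤ Y := by
    intro j hj
    have hjk : j + 1 ≤ k' + 1 := by rw [Finset.mem_range] at hj; omega
    have hA : 0 ≤ ((j : ℝ) + 1) * (2 * sys.obar * Fintype.card Λ) ^ j
        * (4 * sys.hbar * sys.obar * sys.r * Fintype.card Λ) := by positivity
    have hi1 : (‖(sys.orderPlus ^ (j + 1)) Φ‖)⁻¹ ≤ ((μ * sys.obar * Fintype.card Λ) ^ (j + 1))⁻¹ :=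
      inv_anti₀ (pow_pos hs _) (hPm j hjk)
    have hi2 : (‖(sys.orderMinus ^ (j + 1)) Φ‖)⁻¹ ≤ ((μ * sys.obar * Fintype.card Λ) ^ (j + 1))⁻¹ :=
      inv_anti₀ (pow_pos hs _) (hMm j hjk)
    have step1 : (((j : ℝ) + 1) * (2 * sys.obar * Fintype.card Λ) ^ j
              * (4 * sys.hbar * sys.obar * sys.r * Fintype.card Λ))
            * ((‖(sys.orderPlus ^ (j + 1)) Φ‖)⁻¹ + (‖(sys.orderMinus ^ (j + 1)) Φ‖)⁻¹)
        ≤ (((j : ℝ) + 1) * (2 * sys.obar * Fintype.card Λ) ^ j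
              * (4 * sys.hbar * sys.obar * sys.r * Fintype.card Λ))
            * (2 * ((μ * sys.obar * Fintype.card Λ) ^ (j + 1))⁻¹) :=
      mul_le_mul_of_nonneg_left (by linarith) hA
    have e : (((j : ℝ) + 1) * (2 * sys.obar * Fintype.card Λ) ^ j
              * (4 * sys.hbar * sys.obar * sys.r * Fintype.card Λ))
            * (2 * ((μ * sys.obar * Fintype.card Λ) ^ (j + 1))⁻¹)
        = ((j : ℝ) + 1) * 2 ^ (j + 3) * sys.hbar * sys.r / μ ^ (j + 1) := by
      field_simp
      ring
    have step2 : ((j : ℝ) + 1) * 2 ^ (j + 3) * sys.hbar * sys.r / μ ^ (j + 1) ≤ Y := by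
      rw [hYdef, div_le_div_iff₀ (pow_pos hμ _) (pow_pos hμ _)]
      have h1 : (j : ℝ) + 1 ≤ (k' : ℝ) + 1 := by exact_mod_cast hjk
      have h2 : (2 : ℝ) ^ (j + 3) ≤ 2 ^ (k' + 1 + 2) := pow_le_pow_right₀ (by norm_num) (by omega)
      have h3 : μ ^ (k' + 1) ≤ μ ^ (j + 1) := pow_le_pow_of_le_one hμ.le hμ1 hjk
      have hhr : 0 ≤ sys.hbar * sys.r := by positivity
      calc ((j : ℝ) + 1) * 2 ^ (j + 3) * sys.hbar * sys.r * μ ^ (k' + 1)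
          = (((j : ℝ) + 1) * 2 ^ (j + 3)) * (sys.hbar * sys.r) * μ ^ (k' + 1) := by ring
        _ ≤ (((k' : ℝ) + 1) * 2 ^ (k' + 1 + 2)) * (sys.hbar * sys.r) * μ ^ (j + 1) := by
            gcongr
        _ = ((k' : ℝ) + 1) * 2 ^ (k' + 1 + 2) * sys.hbar * sys.r * μ ^ (j + 1) := by ring
    linarith [step1, step2, e.le, e.ge]
  have hsum : ∑ j ∈ range (k' + 1),
      (((j : ℝ) + 1) * (2 * sys.obar * Fintype.card Λ) ^ j
            * (4 * sys.hbar * sys.obar * sys.r * Fintype.card Λ))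
          * ((‖(sys.orderPlus ^ (j + 1)) Φ‖)⁻¹ + (‖(sys.orderMinus ^ (j + 1)) Φ‖)⁻¹)
        ≤ ((k' : ℝ) + 1) * Y := by
    have h := Finset.sum_le_sum hterm
    rw [Finset.sum_const, Finset.card_range, nsmul_eq_mul, Nat.cast_add_one] at h
    exact h
  -- `(2k+1)⁻¹ (k Y) ≤ Y/2 = D_k`
  have hk0 : (0 : ℝ) < 2 * ((k' + 1 : ℕ) : ℝ) + 1 := by positivity
  have hδ : (2 * ((k' + 1 : ℕ) : ℝ) + 1)⁻¹ * ∑ j ∈ range (k' + 1),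
      (((j : ℝ) + 1) * (2 * sys.obar * Fintype.card Λ) ^ j
            * (4 * sys.hbar * sys.obar * sys.r * Fintype.card Λ))
          * ((‖(sys.orderPlus ^ (j + 1)) Φ‖)⁻¹ + (‖(sys.orderMinus ^ (j + 1)) Φ‖)⁻¹)
        ≤ ((k' + 1 : ℕ) : ℝ) * 2 ^ (k' + 1 + 1) * sys.hbar * sys.r / μ ^ (k' + 1) := by
    have h1 : (2 * ((k' + 1 : ℕ) : ℝ) + 1)⁻¹ * (((k' : ℝ) + 1) * Y) ≤ Y / 2 := by
      rw [inv_mul_le_iff₀ hk0]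
      push_cast
      nlinarith
    have h2 : Y / 2 = ((k' + 1 : ℕ) : ℝ) * 2 ^ (k' + 1 + 1) * sys.hbar * sys.r / μ ^ (k' + 1) := by
      rw [hYdef]
      push_cast
      field_simp
      ring
    calc _ ≤ (2 * ((k' + 1 : ℕ) : ℝ) + 1)⁻¹ * (((k' : ℝ) + 1) * Y) :=
          mul_le_mul_of_nonneg_left hsum (inv_nonneg.mpr hk0.le)
      _ ≤ Y / 2 := h1
      _ = _ := h2
  have hδB := div_le_div_of_nonneg_right hδ hB.le
  linarith [hfin, hδB]

end U1OverlapSystem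

/-! ### KT93 Theorem 7.3 as printed: the limit statement (7.11), `ε`–`N₀` form -/

/-- **KT93 Theorem 7.3 (7.11), `U(1)` case, bounded-overlap densities, in `ε`–`N₀` form UNIFORM over the
class.**  For all `μ`, `o`, bounds `R ≥ r′`, `r₀ ≥ r`, `h₀ ≥ h̄`, every field `B > 0` and every `ε > 0` there
is `N₀` (depending only on these) such that for EVERY bounded-overlap `U(1)` system of the class on a
lattice with `N ≥ N₀` sites, every GROUND state `Φ` of `H_Λ` with obscured symmetry breaking iv) (LRO
parameter `μ`), and EVERY ground state `Φ_B` of `H_Λ - B·O^{(1)}_Λ`: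
`N⁻¹ Re⟨Φ_B, O^{(1)}_Λ Φ_B⟩ ≥ √2 μ o - ε`.  Hence `liminf_Λ N⁻¹(Φ_Λ(B), O^{(1)}_ΛΦ_Λ(B)) ≥ √2 σ`
(`σ = μ o`) for every `B > 0` — the volume limit is taken FIRST — and a fortiori the printed (7.11)
`liminf_{B↓0} liminf_Λ N⁻¹(Φ_Λ(B), O^{(1)}_ΛΦ_Λ(B)) ≥ √2 σ`.  At fixed `N` the bound degenerates as
`B ↓ 0` (Tasaki's continuity remark). [cite: KomaTasaki1993, Theorem 7.3 (7.11)] -/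
def komaTasakiU1Field : Prop :=
  ∀ (μ ob h₀ : ℝ) (R r₀ : ℕ) (B ε : ℝ), 0 < B → 0 < ε → ∃ N₀ : ℕ,
    ∀ {Λ : Type u} [Fintype Λ] [Nonempty Λ] {E : Type v} [NormedAddCommGroup E]
      [InnerProductSpace ℂ E] [FiniteDimensional ℂ E] (sys : U1OverlapSystem Λ E) (Φ : E) (EΛ : ℝ),
      sys.IsLROEigenstate Φ EΛ μ → sys.obar = ob → sys.r' ≤ R → sys.r ≤ r₀ → sys.hbar ≤ h₀ →
      (∀ ψ : E, ‖ψ‖ = 1 → EΛ ≤ (⟪ψ, sys.hamiltonian ψ⟫_ℂ).re) →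
      N₀ ≤ Fintype.card Λ →
      ∀ ΦB : E, ‖ΦB‖ = 1 →
        (∀ ψ : E, ‖ψ‖ = 1 →
          (⟪ΦB, (sys.hamiltonian - (B : ℂ) • sys.order 0) ΦB⟫_ℂ).re ≤
            (⟪ψ, (sys.hamiltonian - (B : ℂ) • sys.order 0) ψ⟫_ℂ).re) →
        Real.sqrt 2 * μ * ob - ε ≤ (⟪ΦB, sys.order 0 ΦB⟫_ℂ).re / Fintype.card Λ

/-- **KT93 Theorem 7.3 — PROVED** ("By substituting (7.24) and (7.26) into the basic variational estimate
(7.5), and by letting `N ↑ ∞` and `k ↑ ∞`, one gets the desired (7.11)"): `k` is taken from the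
trial-state half `theorem_2_5_orderOne_overlap_holds` with `ε/2`, and `N₀` large enough for the size
condition `k² R 2^k ≤ μ^{2k} N` and for `D_k/(BN) ≤ ε/2`, `D_k = k 2^{k+1} h₀ r₀ μ^{-k}`.
[cite: KomaTasaki1993, Theorem 7.3 (7.11), proof pp. 212–213] -/
theorem komaTasakiU1Field_holds : komaTasakiU1Field.{u, v} := by
  intro μ ob h₀ R r₀ B ε hB hε
  by_cases hμ : 0 < μ
  swap
  · refine ⟨0, ?_⟩
    intro Λ _ _ E _ _ _ sys Φ EΛ hΦ _ _ _ _ _ _ ΦB _ _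
    exact absurd hΦ.mu_pos hμ
  -- `k` from the trial-state half (7.25)–(7.26) with `ε/2`
  obtain ⟨k₀, hk₀⟩ := theorem_2_5_orderOne_overlap_holds.{u, v} μ ob (ε / 2) R (half_pos hε)
  obtain ⟨N₁, hN₁⟩ := hk₀ (max k₀ 1) (le_max_left _ _)
  set k : ℕ := max k₀ 1 with hk_def
  have hk1 : 1 ≤ k := le_max_right _ _
  -- the `N`-uniform energy constant of the class, the size condition, the `ε/2` condition
  set D : ℝ := (k : ℝ) * 2 ^ (k + 1) * h₀ * r₀ / μ ^ k with hD_def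
  set N₂ : ℕ := ⌈(k : ℝ) ^ 2 * R * 2 ^ k / μ ^ (2 * k)⌉₊ with hN₂_def
  set N₃ : ℕ := ⌈2 * D / (B * ε)⌉₊ with hN₃_def
  refine ⟨max N₁ (max N₂ N₃), ?_⟩
  intro Λ _ _ E _ _ _ sys Φ EΛ hΦ hob hR hr hh hground hN ΦB hΦB hmin
  have hN0 : (0 : ℝ) < Fintype.card Λ := Nat.cast_pos.mpr Fintype.card_pos
  have hNle1 : N₁ ≤ Fintype.card Λ := le_trans (le_max_left _ _) hN
  have hNle2 : (N₂ : ℝ) ≤ Fintype.card Λ := by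
    exact_mod_cast le_trans (le_trans (le_max_left _ _) (le_max_right _ _)) hN
  have hNle3 : (N₃ : ℝ) ≤ Fintype.card Λ := by
    exact_mod_cast le_trans (le_trans (le_max_right _ _) (le_max_right _ _)) hN
  -- the size condition `k² r′ 2^k ≤ μ^{2k} N`
  have hsize : (k : ℝ) ^ 2 * sys.r' * 2 ^ k ≤ μ ^ (2 * k) * Fintype.card Λ := by
    have hμk : 0 < μ ^ (2 * k) := pow_pos hμ _
    have h1 : (k : ℝ) ^ 2 * R * 2 ^ k / μ ^ (2 * k) ≤ Fintype.card Λ := (Nat.le_ceil _).trans hNle2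
    rw [div_le_iff₀ hμk] at h1
    have hR' : (sys.r' : ℝ) ≤ R := by exact_mod_cast hR
    calc (k : ℝ) ^ 2 * sys.r' * 2 ^ k ≤ (k : ℝ) ^ 2 * R * 2 ^ k := by gcongr
      _ ≤ Fintype.card Λ * μ ^ (2 * k) := h1
      _ = μ ^ (2 * k) * Fintype.card Λ := mul_comm _ _
  -- finite-volume Theorem 7.3 and the trial-state half
  have hfin := sys.field_order_ge_xiState_of_card_ge hΦ hground hk1 hsize hB hΦB hmin
  have hx := hN₁ sys Φ EΛ hΦ hob hR hNle1
  -- `D_sys ≤ D`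
  have hhb : 0 ≤ sys.hbar := sys.hbar_nonneg
  have hDsys : (k : ℝ) * 2 ^ (k + 1) * sys.hbar * sys.r / μ ^ k ≤ D := by
    rw [hD_def]
    apply div_le_div_of_nonneg_right _ (pow_pos hμ _).le
    have hr' : (sys.r : ℝ) ≤ r₀ := by exact_mod_cast hr
    have hprod : sys.hbar * sys.r ≤ h₀ * r₀ :=
      calc sys.hbar * sys.r ≤ sys.hbar * r₀ := mul_le_mul_of_nonneg_left hr' hhb
        _ ≤ h₀ * r₀ := mul_le_mul_of_nonneg_right hh (Nat.cast_nonneg _)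
    calc (k : ℝ) * 2 ^ (k + 1) * sys.hbar * sys.r = (k : ℝ) * 2 ^ (k + 1) * (sys.hbar * sys.r) := by
          ring
      _ ≤ (k : ℝ) * 2 ^ (k + 1) * (h₀ * r₀) := mul_le_mul_of_nonneg_left hprod (by positivity)
      _ = (k : ℝ) * 2 ^ (k + 1) * h₀ * r₀ := by ring
  -- `D/B ≤ (ε/2) N`
  have hD0 : 0 ≤ D := le_trans (by positivity) hDsys
  have hDN : D / B ≤ ε / 2 * Fintype.card Λ := by
    have h1 : 2 * D / (B * ε) ≤ Fintype.card Λ := (Nat.le_ceil _).trans hNle3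
    rw [div_le_iff₀ (mul_pos hB hε)] at h1
    rw [div_le_iff₀ hB]
    nlinarith
  -- assemble: `(√2μo - ε)N ≤ (√2μo - ε/2)N - D/B ≤ Re⟨Ξ,O¹Ξ⟩ - D_sys/B ≤ Re⟨Φ_B, O¹Φ_B⟩`
  rw [le_div_iff₀ hN0]
  rw [le_div_iff₀ hN0] at hx
  have hDB := div_le_div_of_nonneg_right hDsys hB.le
  linarith

/-- **KT93 Theorem 7.3 along a sequence of lattices** (`N_j → ∞`, bounded-overlap systems of one class,
a ground state `Φ_j` with obscured symmetry breaking and a sourced ground state `Φ_j(B)` on each): for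
every `B > 0` and `ε > 0`, eventually `N_j⁻¹ Re⟨Φ_j(B), O^{(1)}_j Φ_j(B)⟩ ≥ √2 μ o - ε`.
[cite: KomaTasaki1993, Theorem 7.3 (7.11)] -/
theorem komaTasakiU1Field_seq (Λ : ℕ → Type u) [∀ j, Fintype (Λ j)] [∀ j, Nonempty (Λ j)]
    (E : ℕ → Type v) [∀ j, NormedAddCommGroup (E j)] [∀ j, InnerProductSpace ℂ (E j)]
    [∀ j, FiniteDimensional ℂ (E j)] (sys : ∀ j, U1OverlapSystem (Λ j) (E j)) (Φ : ∀ j, E j)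
    (EΛ : ℕ → ℝ) (μ ob h₀ : ℝ) (R r₀ : ℕ) (hΦ : ∀ j, (sys j).IsLROEigenstate (Φ j) (EΛ j) μ)
    (hob : ∀ j, (sys j).obar = ob) (hR : ∀ j, (sys j).r' ≤ R) (hr : ∀ j, (sys j).r ≤ r₀)
    (hh : ∀ j, (sys j).hbar ≤ h₀)
    (hground : ∀ j (ψ : E j), ‖ψ‖ = 1 → EΛ j ≤ (⟪ψ, (sys j).hamiltonian ψ⟫_ℂ).re)
    (hN : Tendsto (fun j => Fintype.card (Λ j)) atTop atTop) {B : ℝ} (hB : 0 < B)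
    (ΦB : ∀ j, E j) (hΦB : ∀ j, ‖ΦB j‖ = 1)
    (hmin : ∀ j (ψ : E j), ‖ψ‖ = 1 →
      (⟪ΦB j, ((sys j).hamiltonian - (B : ℂ) • (sys j).order 0) (ΦB j)⟫_ℂ).re ≤
        (⟪ψ, ((sys j).hamiltonian - (B : ℂ) • (sys j).order 0) ψ⟫_ℂ).re) :
    ∀ ε : ℝ, 0 < ε → ∀ᶠ j in atTop,
      Real.sqrt 2 * μ * ob - ε ≤ (⟪ΦB j, (sys j).order 0 (ΦB j)⟫_ℂ).re / Fintype.card (Λ j) := by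
  intro ε hε
  obtain ⟨N₀, hN₀⟩ := komaTasakiU1Field_holds.{u, v} μ ob h₀ R r₀ B ε hB hε
  filter_upwards [Filter.tendsto_atTop.mp hN N₀] with j hj
  exact hN₀ (sys j) (Φ j) (EΛ j) (hΦ j) (hob j) (hR j) (hr j) (hh j) (hground j) hj (ΦB j) (hΦB j)
    (hmin j)

/-! ### The `U1System` specialisation (hypothesis i), `r′ = 1`) -/

namespace U1System

variable {Λ : Type u} [Fintype Λ] {E : Type v} [NormedAddCommGroup E] [InnerProductSpace ℂ E]

/-- `Ξ^{(k)}` depends on the system only through `O^±`: two systems (possibly on different lattices)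
with the same `O^+` and `O^-` have the same trial states. [cite: KomaTasaki1994, (2.19), (2.27)] -/
theorem xiState_congr {Λ₁ : Type*} [Fintype Λ₁] {Λ₂ : Type*} [Fintype Λ₂] (S₁ : U1System Λ₁ E)
    (S₂ : U1System Λ₂ E) (hp : S₁.orderPlus = S₂.orderPlus) (hm : S₁.orderMinus = S₂.orderMinus)
    (k : ℕ) (Φ : E) : S₁.xiState k Φ = S₂.xiState k Φ := by
  have hpow : ∀ M : ℤ, S₁.orderPow M = S₂.orderPow M := fun M => by
    unfold U1System.orderPow; rw [hp, hm]
  unfold U1System.xiState U1System.trialState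
  simp_rw [hpow]

variable [DecidableEq Λ] (S : U1System Λ E)

/-- `toOverlap` keeps the Hamiltonian. [cite: KomaTasaki1994, (2.3)] -/
theorem toOverlap_hamiltonian : S.toOverlap.hamiltonian = S.hamiltonian := rfl

/-- `toOverlap` keeps the order operators. [cite: KomaTasaki1994, (2.13)] -/
theorem toOverlap_order (α : Fin 2) : S.toOverlap.order α = S.order α := rfl

/-- `toOverlap` keeps `h̄`. [cite: KomaTasaki1994, §2.3 iii)] -/
theorem toOverlap_hbar : S.toOverlap.hbar = S.hbar := rfl

/-- `toOverlap` keeps `o`. [cite: KomaTasaki1994, §2.3 iii)] -/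
theorem toOverlap_obar : S.toOverlap.obar = S.obar := rfl

/-- `toOverlap` keeps `r`. [cite: KomaTasaki1994, §2.3 ii)] -/
theorem toOverlap_r : S.toOverlap.r = S.r := rfl

/-- `toOverlap` has overlap bound `r′ = 1`. [cite: KomaTasaki1994, §2.3 i)] -/
theorem toOverlap_r' : S.toOverlap.r' = 1 := rfl

variable [Nonempty Λ]

/-- `toOverlap` keeps `O^+`. [cite: KomaTasaki1994, (2.15)] -/
theorem toOverlap_orderPlus : S.toOverlap.orderPlus = S.orderPlus := by
  rw [U1OverlapSystem.orderPlus_eq]; rfl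

/-- `toOverlap` keeps `O^-`. [cite: KomaTasaki1994, (2.15)] -/
theorem toOverlap_orderMinus : S.toOverlap.orderMinus = S.orderMinus := by
  rw [U1OverlapSystem.orderMinus_eq]; rfl

/-- `toOverlap` keeps the trial states `Ξ^{(k)}`. [cite: KomaTasaki1994, (2.27)] -/
theorem toOverlap_xiState (k : ℕ) (Φ : E) : S.toOverlap.xiState k Φ = S.xiState k Φ :=
  xiState_congr _ _ S.toOverlap_orderPlus S.toOverlap_orderMinus k Φ

/-- `toOverlap` keeps hypothesis iv). [cite: KomaTasaki1994, §2.3 iv) (2.17)] -/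
theorem toOverlap_isLROEigenstate {Φ : E} {EΛ μ : ℝ} (hΦ : IsLROEigenstate S Φ EΛ μ) :
    S.toOverlap.IsLROEigenstate Φ EΛ μ :=
  S.toOverlap.isLROEigenstate_of hΦ.norm_eq_one hΦ.eigen_hamiltonian hΦ.eigen_C hΦ.mu_pos
    hΦ.mu_le_one hΦ.lro hΦ.lro_eq

/-- **KT93 Theorem 7.3 in finite volume for a Koma–Tasaki `U1System`** (hypothesis i); `r′ = 1`):
under `k² 2^k ≤ μ^{2k} N`, for a ground state `Φ` with obscured symmetry breaking iv) and every ground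
state `Φ_B` of `H_Λ - B O^{(1)}_Λ`, `B > 0`,
`Re⟨Φ_B, O^{(1)}Φ_B⟩ ≥ Re⟨Ξ^{(k)}, O^{(1)}Ξ^{(k)}⟩ - k 2^{k+1} h̄ r μ^{-k}/B`
(and `Re⟨Ξ^{(k)}, O^{(1)}Ξ^{(k)}⟩` is bounded below by `U1System.theorem_2_5_orderOne_fin`).
[cite: KomaTasaki1993, Theorem 7.3, proof (7.5), (7.23)–(7.26)] -/
theorem field_order_ge_xiState_of_card_ge [FiniteDimensional ℂ E] {Φ : E} {EΛ μ : ℝ}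
    (hΦ : IsLROEigenstate S Φ EΛ μ)
    (hground : ∀ ψ : E, ‖ψ‖ = 1 → EΛ ≤ (⟪ψ, S.hamiltonian ψ⟫_ℂ).re)
    {k : ℕ} (hk : 1 ≤ k) (hN : (k : ℝ) ^ 2 * 2 ^ k ≤ μ ^ (2 * k) * Fintype.card Λ)
    {B : ℝ} (hB : 0 < B) {ΦB : E} (hΦB : ‖ΦB‖ = 1)
    (hmin : ∀ ψ : E, ‖ψ‖ = 1 →
      (⟪ΦB, (S.hamiltonian - (B : ℂ) • S.order 0) ΦB⟫_ℂ).re ≤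
        (⟪ψ, (S.hamiltonian - (B : ℂ) • S.order 0) ψ⟫_ℂ).re) :
    (⟪S.xiState k Φ, S.order 0 (S.xiState k Φ)⟫_ℂ).re
        - ((k : ℝ) * 2 ^ (k + 1) * S.hbar * S.r / μ ^ k) / B
      ≤ (⟪ΦB, S.order 0 ΦB⟫_ℂ).re := by
  have hN' : (k : ℝ) ^ 2 * S.toOverlap.r' * 2 ^ k ≤ μ ^ (2 * k) * Fintype.card Λ := by
    rw [toOverlap_r', Nat.cast_one, mul_one]; exact hN
  have h := S.toOverlap.field_order_ge_xiState_of_card_ge (S.toOverlap_isLROEigenstate hΦ) hground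
    hk hN' hB hΦB hmin
  rw [toOverlap_xiState] at h
  exact h

end U1System

/-- **KT93 Theorem 7.3 (7.11) for Koma–Tasaki `U1System`s** (hypothesis i)), `ε`–`N₀` form uniform over
the class `(μ, o, r ≤ r₀, h̄ ≤ h₀)`: for every `B > 0`, `ε > 0` there is `N₀` with
`N⁻¹ Re⟨Φ_B, O^{(1)}Φ_B⟩ ≥ √2 μ o - ε` for every system of the class on `N ≥ N₀` sites, every ground state
`Φ` with obscured symmetry breaking iv) and every ground state `Φ_B` of `H_Λ - B O^{(1)}_Λ`.
[cite: KomaTasaki1993, Theorem 7.3 (7.11)] -/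
theorem komaTasakiU1Field_u1 (μ ob h₀ : ℝ) (r₀ : ℕ) {B ε : ℝ} (hB : 0 < B) (hε : 0 < ε) :
    ∃ N₀ : ℕ, ∀ {Λ : Type u} [Fintype Λ] [Nonempty Λ] {E : Type v} [NormedAddCommGroup E]
      [InnerProductSpace ℂ E] [FiniteDimensional ℂ E] (S : U1System Λ E) (Φ : E) (EΛ : ℝ),
      IsLROEigenstate S Φ EΛ μ → S.obar = ob → S.r ≤ r₀ → S.hbar ≤ h₀ →
      (∀ ψ : E, ‖ψ‖ = 1 → EΛ ≤ (⟪ψ, S.hamiltonian ψ⟫_ℂ).re) →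
      N₀ ≤ Fintype.card Λ →
      ∀ ΦB : E, ‖ΦB‖ = 1 →
        (∀ ψ : E, ‖ψ‖ = 1 →
          (⟪ΦB, (S.hamiltonian - (B : ℂ) • S.order 0) ΦB⟫_ℂ).re ≤
            (⟪ψ, (S.hamiltonian - (B : ℂ) • S.order 0) ψ⟫_ℂ).re) →
        Real.sqrt 2 * μ * ob - ε ≤ (⟪ΦB, S.order 0 ΦB⟫_ℂ).re / Fintype.card Λ := by
  obtain ⟨N₀, hN₀⟩ := komaTasakiU1Field_holds.{u, v} μ ob h₀ 1 r₀ B ε hB hε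
  refine ⟨N₀, ?_⟩
  intro Λ _ _ E _ _ _ S Φ EΛ hΦ hob hr hh hground hN ΦB hΦB hmin
  classical
  exact hN₀ S.toOverlap Φ EΛ (S.toOverlap_isLROEigenstate hΦ) hob (le_of_eq S.toOverlap_r') hr hh
    hground hN ΦB hΦB hmin

end Literature.MathematicalPhysics.QuantumLattice.KomaTasaki
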